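import Summits.AtomisticToContinuum.FouriersLaw.Theorems.VanishingNoiseTransferVanishingNoiseBoundFlipDualKuboIdentity
import Summits.AtomisticToContinuum.FouriersLaw.Theorems.VanishingNoiseTransferVanishingNoiseBoundFlipResponseFrame
import Literature.MathematicalPhysics.KineticTheory.VelocityFlipNoise
import HarnessLib

/-!
# Fixed-`N` linear response of the flip chain: ROAD B (the dual Kubo road)
(helper for stub `stub_flipFiniteResponse` of line `sector-dirichlet-gluing`,
crux `VanishingNoiseTransfer.NoisyFourier`, item stmt-AtomisticToContinuum-11977)

`flipFiniteResponse_of_dualKuboRoad` — **ROAD B adapter.** The hypothesis is VERBATIM the hypothesis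
`H_road` of the registered assembly stub `stub_dualKuboRoadLanded` of the sister crux `VanishingNoiseBound`
(stmt-AtomisticToContinuum-11976, line `fekete-usc-one-length`): for the unique flip-steady family `μ` and
every `L ≥ 2` it provides a `δ`-dependent forward field `g δ` of `L_{T+δ/2,T−δ/2} + εS` with
`|g δ| ≤ C e^{H/(4T)}`, measurable and solving, for `0 < |δ| < δ₀`, the distributional equation
`(L_δ + εS) g_δ = −(p_0² − T) + c_δ`, `c_δ = ∫ (p_0² − T) dμ_δ` (tested against `C_c^∞` through the
Lebesgue transpose), together with the continuity at `δ = 0` of the two Gibbs pairings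
`A_δ = ⟨g_δ, p_0² − T⟩_{μ_T} → A_0`, `B_δ = ⟨g_δ, p_{L−1}² − T⟩_{μ_T} → B_0`.

The conclusion is `stub_flipFiniteResponse` VERBATIM (existence of
`D_N = lim_{δ→0, δ≠0} totalCurrent(μ_{N,T+δ/2,T−δ/2})/δ` under uniqueness, along a flip-steady family).
Proof: `N ≤ 1` — no bond (the total current vanishes identically). `N ≥ 2` — the PROVED exact dual response
identity `flip_dualKubo_identity` (…FlipDualKuboIdentity, `ϑ = 1/(4T) < 1/T`) with `T_L = T + δ/2`,
`T_R = T − δ/2`, `u = g δ`, `c = c_δ` reads `c_δ = (γ/T²)((δ/2)A_δ − (δ/2)B_δ)`; since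
`c_δ = ∫ p_0² dμ_δ − T` (`integrable_sq_momentum_left`), `(∫ p_0² dμ_δ − T)/δ = (γ/(2T²))(A_δ − B_δ) →
(γ/(2T²))(A_0 − B_0) =: s`, and `totalCurrent(μ_δ) = (N−1)γ(T + δ/2 − ∫ p_0² dμ_δ)` for `|δ| < 2T`
(`totalCurrent_family_eq`, …FlipResponseFrame) gives `totalCurrent(μ_δ)/δ → (N−1)γ(1/2 − s)`.
The clauses `ContDiff ℝ 2 (g 0)` and the classical equation at `δ = 0` of `H_road` are not used.

References: Bonetto–Lebowitz–Rey-Bellet 2000 eq. (27), (32); Rey-Bellet 2003 Rem. 4.4; Bernardin–Olla 2011 §2.1.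
-/

noncomputable section

namespace Summit.AtomisticToContinuum.FouriersLaw.Theorems.NoisyFourier.FlipFiniteResponse

open MeasureTheory Filter Topology Set
open scoped BigOperators
open Literature.MathematicalPhysics.KineticTheory
open Literature.MathematicalPhysics.KineticTheory.HeatConduction
open Summit.AtomisticToContinuum.FouriersLaw.Theorems.VanishingNoiseBound
open Summit.AtomisticToContinuum.FouriersLaw.Theorems.SuperadditiveResistance.DeviceLiouville (kin kin_eq_sq)

section RoadB

variable {ω₂ lam β γ : ℝ}

/-- Near `δ = 0`, `δ ≠ 0`: `0 < |δ| < δ₀` and `|δ| < 2T`. [folklore] -/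
theorem eventually_abs_pos_lt {δ₀ T : ℝ} (hδ₀ : 0 < δ₀) (hT : 0 < T) :
    ∀ᶠ δ : ℝ in 𝓝[≠] 0, 0 < |δ| ∧ |δ| < δ₀ ∧ |δ| < 2 * T := by
  have h : Metric.ball (0 : ℝ) (min δ₀ (2 * T)) ∈ 𝓝 (0 : ℝ) :=
    Metric.ball_mem_nhds 0 (lt_min hδ₀ (by positivity))
  filter_upwards [nhdsWithin_le_nhds h, self_mem_nhdsWithin] with δ hδ hδ0
  have hδ' : |δ| < min δ₀ (2 * T) := by simpa [Metric.mem_ball, Real.dist_eq] using hδ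
  exact ⟨abs_pos.2 hδ0, lt_of_lt_of_le hδ' (min_le_left _ _), lt_of_lt_of_le hδ' (min_le_right _ _)⟩

/-- **The centring constant of the dual road is the left-end temperature excess**: for a weak flip steady
state `ν` of the pinned chain (`N ≥ 1`), `∫ (kin N 0 y − T) dν = ∫ p_0² dν − T`. [folklore] -/
theorem integral_kin_sub_eq (hω : 0 < ω₂) (hl : 0 ≤ lam) (hβ : 0 ≤ β) (hγ : 0 < γ) {N : ℕ} (hN : 0 < N)
    {T_L T_R ε : ℝ} (T : ℝ) {ν : Measure (PhaseSpace N)}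
    (hν : (pinnedChain ω₂ lam β γ).IsFlipSteadyState N T_L T_R ε ν) :
    ∫ y, (kin N 0 y - T) ∂ν = (∫ y, y.2 ⟨0, hN⟩ ^ 2 ∂ν) - T := by
  haveI : IsProbabilityMeasure ν := hν.1
  have hint : Integrable (fun x : PhaseSpace N => x.2 ⟨0, hN⟩ ^ 2) ν :=
    integrable_sq_momentum_left hω hl hβ hγ hN hν
  have e : (fun y : PhaseSpace N => kin N 0 y - T) = fun y => y.2 ⟨0, hN⟩ ^ 2 - T := by
    funext y; rw [kin_eq_sq hN y]
  rw [e, integral_sub hint (integrable_const T), integral_const, probReal_univ, one_smul]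

/-- **ROAD B: the slope of the left-end kinetic temperature from the dual Kubo road.** In the frame
(`ω₂, lam, β, γ, T > 0`, flip-steady family `μ`, `N ≥ 2`), a `δ`-family `g δ` of measurable,
`e^{H/(4T)}`-bounded distributional solutions of `(L_{T+δ/2,T−δ/2} + εS) g_δ = −(p_0² − T) + c_δ`,
`c_δ = ∫ (p_0² − T) dμ_δ`, for `0 < |δ| < δ₀`, whose Gibbs pairings `A_δ`, `B_δ` with `p_0² − T`,
`p_{N−1}² − T` converge to `A_0`, `B_0`, forces `(∫ p_0² dμ_δ − T)/δ → (γ/(2T²))(A_0 − B_0)`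
(`flip_dualKubo_identity`). [Bonetto–Lebowitz–Rey-Bellet 2000, eq. (32)] [folklore] -/
theorem tendsto_endSlope_of_dualRoad (hω : 0 < ω₂) (hl : 0 ≤ lam) (hβ : 0 ≤ β) (hγ : 0 < γ) {T : ℝ}
    (hT : 0 < T) (ε : ℝ) {μ : (N : ℕ) → ℝ → ℝ → Measure (PhaseSpace N)}
    (hμ : ∀ (N : ℕ) (T_L T_R : ℝ), 0 < T_L → 0 < T_R →
      (pinnedChain ω₂ lam β γ).IsFlipSteadyState N T_L T_R ε (μ N T_L T_R))
    {N : ℕ} (h2 : 2 ≤ N) {g : ℝ → PhaseSpace N → ℝ} {δ₀ : ℝ} (hδ₀ : 0 < δ₀)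
    (hbound : ∀ δ, |δ| < δ₀ → ∃ C : ℝ, ∀ x,
      |g δ x| ≤ C * Real.exp (1 / (4 * T) * (pinnedChain ω₂ lam β γ).hamiltonian N x))
    (hweak : ∀ δ, 0 < |δ| → |δ| < δ₀ → Measurable (g δ) ∧
      ∀ φ : PhaseSpace N → ℝ, ContDiff ℝ ((⊤ : ℕ∞) : WithTop ℕ∞) φ → HasCompactSupport φ →
        ∫ x, g δ x * (-((pinnedChain ω₂ lam β γ).generator N (T + δ / 2) (T - δ / 2) φ x) +
            2 * γ * ((T + δ / 2) * partialP (⟨0, by omega⟩ : Fin N) (partialP (⟨0, by omega⟩ : Fin N) φ) x +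
              (T - δ / 2) * partialP (⟨N - 1, by omega⟩ : Fin N)
                (partialP (⟨N - 1, by omega⟩ : Fin N) φ) x) +
            2 * γ * φ x + ε * flipNoise N φ x) =
          ∫ x, (-(kin N 0 x - T) + ∫ y, (kin N 0 y - T) ∂(μ N (T + δ / 2) (T - δ / 2))) * φ x)
    {A₀ B₀ : ℝ}
    (hA : Tendsto (fun δ => ∫ x, g δ x * (kin N 0 x - T) ∂((pinnedChain ω₂ lam β γ).gibbsMeasure N T))
      (𝓝[≠] 0) (𝓝 A₀))
    (hB : Tendsto (fun δ => ∫ x, g δ x * (kin N (N - 1) x - T) ∂((pinnedChain ω₂ lam β γ).gibbsMeasure N T))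
      (𝓝[≠] 0) (𝓝 B₀)) :
    Tendsto (fun δ : ℝ => ((∫ x, x.2 ⟨0, (by omega : 0 < N)⟩ ^ 2 ∂(μ N (T + δ / 2) (T - δ / 2))) - T) / δ)
      (𝓝[≠] 0) (𝓝 (γ / (2 * T ^ 2) * (A₀ - B₀))) := by
  have hN : 0 < N := by omega
  have hϑ : 1 / (4 * T) < 1 / T := one_div_lt_one_div_of_lt hT (by linarith)
  refine (((hA.sub hB).const_mul (γ / (2 * T ^ 2)))).congr' ?_
  filter_upwards [eventually_abs_pos_lt hδ₀ hT] with δ ⟨hδ0, hδ1, hδ2⟩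
  obtain ⟨h1, h2'⟩ := abs_lt.mp hδ2
  have hL : 0 < T + δ / 2 := by linarith
  have hR : 0 < T - δ / 2 := by linarith
  have hδ : δ ≠ 0 := abs_pos.mp hδ0
  obtain ⟨C, hC⟩ := hbound δ hδ1
  obtain ⟨hmeas, hw⟩ := hweak δ hδ0 hδ1
  have hid := flip_dualKubo_identity hω hl hβ h2 hT (T + δ / 2) (T - δ / 2) ε
    (∫ y, (kin N 0 y - T) ∂(μ N (T + δ / 2) (T - δ / 2))) hmeas.aestronglyMeasurable hϑ hC hw
  rw [integral_kin_sub_eq hω hl hβ hγ hN T (hμ N _ _ hL hR)] at hid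
  rw [hid]
  field_simp
  ring

/-- **ROAD B adapter.** The hypothesis is verbatim the hypothesis `H_road` of the registered assembly
stub `stub_dualKuboRoadLanded` of the sister crux `VanishingNoiseBound` (stmt-AtomisticToContinuum-11976);
the conclusion is `stub_flipFiniteResponse` of line `sector-dirichlet-gluing` verbatim. See the module
docstring for the proof (`flip_dualKubo_identity` + `totalCurrent_family_eq`; `D = 0` for `N ≤ 1`,
`D = (N−1)γ(1/2 − (γ/(2T²))(A_0 − B_0))` for `N ≥ 2`).
[Bonetto–Lebowitz–Rey-Bellet 2000, eq. (32); Rey-Bellet 2003, Rem. 4.4] [folklore] -/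
theorem flipFiniteResponse_of_dualKuboRoad
    (hroad : ∀ (ω₂ lam β γ T ε : ℝ), 0 < ω₂ → 0 < lam → 0 < β → 0 < γ → 0 < T → 0 < ε →
      ∀ μ : (N : ℕ) → ℝ → ℝ → Measure (PhaseSpace N),
      (∀ (N : ℕ) (T_L T_R : ℝ), 0 < T_L → 0 < T_R →
        (pinnedChain ω₂ lam β γ).IsFlipSteadyState N T_L T_R ε (μ N T_L T_R) ∧
          ∀ ν : Measure (PhaseSpace N), (pinnedChain ω₂ lam β γ).IsFlipSteadyState N T_L T_R ε ν →
            ν = μ N T_L T_R) →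
      ∀ (L : ℕ) (hL : 2 ≤ L), ∃ (g : ℝ → PhaseSpace L → ℝ) (δ₀ : ℝ), 0 < δ₀ ∧ ContDiff ℝ 2 (g 0) ∧
        (∀ x, (pinnedChain ω₂ lam β γ).flipGenerator L T T ε (g 0) x =
          -(Theorems.SuperadditiveResistance.DeviceLiouville.kin L 0 x - T)) ∧
        (∀ δ, |δ| < δ₀ → ∃ C : ℝ, ∀ x,
          |g δ x| ≤ C * Real.exp (1 / (4 * T) * (pinnedChain ω₂ lam β γ).hamiltonian L x)) ∧
        (∀ δ, 0 < |δ| → |δ| < δ₀ → Measurable (g δ) ∧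
          ∀ φ : PhaseSpace L → ℝ, ContDiff ℝ ((⊤ : ℕ∞) : WithTop ℕ∞) φ → HasCompactSupport φ →
            ∫ x, g δ x * (-((pinnedChain ω₂ lam β γ).generator L (T + δ / 2) (T - δ / 2) φ x) +
                2 * γ * ((T + δ / 2) * partialP (⟨0, by omega⟩ : Fin L) (partialP (⟨0, by omega⟩ : Fin L) φ) x +
                  (T - δ / 2) * partialP (⟨L - 1, by omega⟩ : Fin L)
                    (partialP (⟨L - 1, by omega⟩ : Fin L) φ) x) +
                2 * γ * φ x + ε * flipNoise L φ x) =
              ∫ x, (-(Theorems.SuperadditiveResistance.DeviceLiouville.kin L 0 x - T) +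
                ∫ y, (Theorems.SuperadditiveResistance.DeviceLiouville.kin L 0 y - T)
                  ∂(μ L (T + δ / 2) (T - δ / 2))) * φ x) ∧
        Tendsto (fun δ => ∫ x, g δ x * (Theorems.SuperadditiveResistance.DeviceLiouville.kin L 0 x - T)
          ∂((pinnedChain ω₂ lam β γ).gibbsMeasure L T)) (𝓝[≠] 0)
          (𝓝 (∫ x, g 0 x * (Theorems.SuperadditiveResistance.DeviceLiouville.kin L 0 x - T)
            ∂((pinnedChain ω₂ lam β γ).gibbsMeasure L T))) ∧
        Tendsto (fun δ => ∫ x, g δ x * (Theorems.SuperadditiveResistance.DeviceLiouville.kin L (L - 1) x - T)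
          ∂((pinnedChain ω₂ lam β γ).gibbsMeasure L T)) (𝓝[≠] 0)
          (𝓝 (∫ x, g 0 x * (Theorems.SuperadditiveResistance.DeviceLiouville.kin L (L - 1) x - T)
            ∂((pinnedChain ω₂ lam β γ).gibbsMeasure L T)))) :
    ∀ ω₂ lam β γ : ℝ, 0 < ω₂ → 0 < lam → 0 < β → 0 < γ → ∀ ε : ℝ, 0 < ε →
      (∀ (N : ℕ) (T_L T_R : ℝ), 0 < T_L → 0 < T_R →
        ∀ μ ν : MeasureTheory.Measure
            (Literature.MathematicalPhysics.KineticTheory.HeatConduction.PhaseSpace N),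
          (Literature.MathematicalPhysics.KineticTheory.HeatConduction.pinnedChain
              ω₂ lam β γ).IsFlipSteadyState N T_L T_R ε μ →
          (Literature.MathematicalPhysics.KineticTheory.HeatConduction.pinnedChain
              ω₂ lam β γ).IsFlipSteadyState N T_L T_R ε ν → μ = ν) →
      ∀ μ : (N : ℕ) → ℝ → ℝ → MeasureTheory.Measure
          (Literature.MathematicalPhysics.KineticTheory.HeatConduction.PhaseSpace N),
        (∀ (N : ℕ) (T_L T_R : ℝ), 0 < T_L → 0 < T_R →
          (Literature.MathematicalPhysics.KineticTheory.HeatConduction.pinnedChain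
              ω₂ lam β γ).IsFlipSteadyState N T_L T_R ε (μ N T_L T_R)) →
        ∀ T : ℝ, 0 < T → ∀ N : ℕ, ∃ D : ℝ,
          Filter.Tendsto (fun δ : ℝ =>
            (Literature.MathematicalPhysics.KineticTheory.HeatConduction.pinnedChain
                ω₂ lam β γ).totalCurrent (μ N (T + δ / 2) (T - δ / 2)) / δ)
            (nhdsWithin 0 {(0 : ℝ)}ᶜ) (nhds D) := by
  intro ω₂ lam β γ hω hl hβ hγ ε hε huniq μ hμ T hT N
  rcases le_or_gt N 1 with hN1 | hN1
  · -- no bond: the total current vanishes identically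
    have hzero : ∀ ν : Measure (PhaseSpace N), (pinnedChain ω₂ lam β γ).totalCurrent ν = 0 := by
      intro ν
      unfold OscillatorChain.totalCurrent
      refine Finset.sum_eq_zero fun i _ => ?_
      have hi : N ≤ i.val + 1 := by have := i.isLt; omega
      simp [(pinnedChain ω₂ lam β γ).bondCurrent_eq_zero_of_le i hi]
    refine ⟨0, ?_⟩
    simp only [hzero, zero_div]
    exact tendsto_const_nhds
  have h2 : 2 ≤ N := by omega
  have hN : 0 < N := by omega
  have hframe : ∀ (N : ℕ) (T_L T_R : ℝ), 0 < T_L → 0 < T_R →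
      (pinnedChain ω₂ lam β γ).IsFlipSteadyState N T_L T_R ε (μ N T_L T_R) ∧
        ∀ ν : Measure (PhaseSpace N), (pinnedChain ω₂ lam β γ).IsFlipSteadyState N T_L T_R ε ν →
          ν = μ N T_L T_R :=
    fun N T_L T_R hL hR =>
      ⟨hμ N T_L T_R hL hR, fun ν hν => huniq N T_L T_R hL hR ν _ hν (hμ N T_L T_R hL hR)⟩
  obtain ⟨g, δ₀, hδ₀, -, -, hbound, hweak, hA, hB⟩ :=
    hroad ω₂ lam β γ T ε hω hl hβ hγ hT hε μ hframe N h2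
  have hs := tendsto_endSlope_of_dualRoad hω hl.le hβ.le hγ hT ε hμ h2 hδ₀ hbound hweak hA hB
  refine ⟨_, ((((tendsto_const_nhds (x := (1 : ℝ) / 2)).sub hs).const_mul (((N : ℝ) - 1) * γ))).congr' ?_⟩
  filter_upwards [eventually_abs_lt_two_mul hT, self_mem_nhdsWithin] with δ hδ hδ0
  have hδ' : δ ≠ 0 := hδ0
  rw [totalCurrent_family_eq hω hl.le hβ.le hγ hμ hN hδ]
  field_simp
  ring

/-- **ROAD B, per `N`: the response limit and its value.** In the frame (`ω₂, γ, T > 0`, `lam, β ≥ 0`,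
flip-steady family `μ`, `N ≥ 2`), the `δ`-family of the dual road (measurable `e^{H/(4T)}`-bounded distributional
solutions `g δ` with the centring constants `∫ (p_0² − T) dμ_δ`, `0 < |δ| < δ₀`, Gibbs pairings `A_δ → A_0`,
`B_δ → B_0`) gives `totalCurrent(μ_{N,T+δ/2,T−δ/2})/δ → (N−1)γ(1/2 − (γ/(2T²))(A_0 − B_0))`.
[Bonetto–Lebowitz–Rey-Bellet 2000, eq. (27), (32)] [folklore] -/
theorem tendsto_response_of_dualRoad (hω : 0 < ω₂) (hl : 0 ≤ lam) (hβ : 0 ≤ β) (hγ : 0 < γ) {T : ℝ}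
    (hT : 0 < T) (ε : ℝ) {μ : (N : ℕ) → ℝ → ℝ → Measure (PhaseSpace N)}
    (hμ : ∀ (N : ℕ) (T_L T_R : ℝ), 0 < T_L → 0 < T_R →
      (pinnedChain ω₂ lam β γ).IsFlipSteadyState N T_L T_R ε (μ N T_L T_R))
    {N : ℕ} (h2 : 2 ≤ N) {g : ℝ → PhaseSpace N → ℝ} {δ₀ : ℝ} (hδ₀ : 0 < δ₀)
    (hbound : ∀ δ, |δ| < δ₀ → ∃ C : ℝ, ∀ x,
      |g δ x| ≤ C * Real.exp (1 / (4 * T) * (pinnedChain ω₂ lam β γ).hamiltonian N x))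
    (hweak : ∀ δ, 0 < |δ| → |δ| < δ₀ → Measurable (g δ) ∧
      ∀ φ : PhaseSpace N → ℝ, ContDiff ℝ ((⊤ : ℕ∞) : WithTop ℕ∞) φ → HasCompactSupport φ →
        ∫ x, g δ x * (-((pinnedChain ω₂ lam β γ).generator N (T + δ / 2) (T - δ / 2) φ x) +
            2 * γ * ((T + δ / 2) * partialP (⟨0, by omega⟩ : Fin N) (partialP (⟨0, by omega⟩ : Fin N) φ) x +
              (T - δ / 2) * partialP (⟨N - 1, by omega⟩ : Fin N)
                (partialP (⟨N - 1, by omega⟩ : Fin N) φ) x) +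
            2 * γ * φ x + ε * flipNoise N φ x) =
          ∫ x, (-(kin N 0 x - T) + ∫ y, (kin N 0 y - T) ∂(μ N (T + δ / 2) (T - δ / 2))) * φ x)
    {A₀ B₀ : ℝ}
    (hA : Tendsto (fun δ => ∫ x, g δ x * (kin N 0 x - T) ∂((pinnedChain ω₂ lam β γ).gibbsMeasure N T))
      (𝓝[≠] 0) (𝓝 A₀))
    (hB : Tendsto (fun δ => ∫ x, g δ x * (kin N (N - 1) x - T) ∂((pinnedChain ω₂ lam β γ).gibbsMeasure N T))
      (𝓝[≠] 0) (𝓝 B₀)) :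
    Tendsto (fun δ : ℝ => (pinnedChain ω₂ lam β γ).totalCurrent (μ N (T + δ / 2) (T - δ / 2)) / δ)
      (𝓝[≠] 0) (𝓝 (((N : ℝ) - 1) * γ * (1 / 2 - γ / (2 * T ^ 2) * (A₀ - B₀)))) := by
  have hN : 0 < N := by omega
  have hs := tendsto_endSlope_of_dualRoad hω hl hβ hγ hT ε hμ h2 hδ₀ hbound hweak hA hB
  refine ((((tendsto_const_nhds (x := (1 : ℝ) / 2)).sub hs).const_mul (((N : ℝ) - 1) * γ))).congr' ?_
  filter_upwards [eventually_abs_lt_two_mul hT, self_mem_nhdsWithin] with δ hδ hδ0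
  have hδ' : δ ≠ 0 := hδ0
  rw [totalCurrent_family_eq hω hl hβ hγ hμ hN hδ]
  field_simp
  ring

end RoadB

/-! ## Registered helper -/

/-- Registered helper sub-goal `helper_flipFiniteResponseOfDualKuboRoad` of stub `stub_flipFiniteResponse`
(line `sector-dirichlet-gluing`, crux stmt-AtomisticToContinuum-11977): ROAD B per `N` — the `δ`-family of the dual
Kubo road of stmt-AtomisticToContinuum-11976 (measurable `e^{H/(4T)}`-bounded distributional solutions with the
centring constants of the flip-steady family, and the two Gibbs-pairing limits) gives the response limit and its
value (`tendsto_response_of_dualRoad`, notation-free restatement; the road-level adapter with the verbatim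
hypothesis of `stub_dualKuboRoadLanded` is `flipFiniteResponse_of_dualKuboRoad`). [folklore] -/
theorem helper_flipFiniteResponseOfDualKuboRoad : ∀ (ω₂ lam β γ : ℝ), 0 < ω₂ → 0 ≤ lam → 0 ≤ β → 0 < γ → ∀ (T : ℝ), 0 < T → ∀ (ε : ℝ) (μ : (N : ℕ) → ℝ → ℝ → MeasureTheory.Measure (Literature.MathematicalPhysics.KineticTheory.HeatConduction.PhaseSpace N)), (∀ (N : ℕ) (T_L T_R : ℝ), 0 < T_L → 0 < T_R → (Literature.MathematicalPhysics.KineticTheory.HeatConduction.pinnedChain ω₂ lam β γ).IsFlipSteadyState N T_L T_R ε (μ N T_L T_R)) → ∀ (N : ℕ) (h2 : 2 ≤ N) (g : ℝ → Literature.MathematicalPhysics.KineticTheory.HeatConduction.PhaseSpace N → ℝ) (δ₀ : ℝ), 0 < δ₀ → (∀ δ, |δ| < δ₀ → ∃ C : ℝ, ∀ x, |g δ x| ≤ C * Real.exp (1 / (4 * T) * (Literature.MathematicalPhysics.KineticTheory.HeatConduction.pinnedChain ω₂ lam β γ).hamiltonian N x)) → (∀ δ, 0 < |δ| → |δ| <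 δ₀ → Measurable (g δ) ∧ ∀ φ : Literature.MathematicalPhysics.KineticTheory.HeatConduction.PhaseSpace N → ℝ, ContDiff ℝ ((⊤ : ℕ∞) : WithTop ℕ∞) φ → HasCompactSupport φ → ∫ x, g δ x * (-((Literature.MathematicalPhysics.KineticTheory.HeatConduction.pinnedChain ω₂ lam β γ).generator N (T + δ / 2) (T - δ / 2) φ x) + 2 * γ * ((T + δ / 2) * Literature.MathematicalPhysics.KineticTheory.HeatConduction.partialP (⟨0, by omega⟩ : Fin N) (Literature.MathematicalPhysics.KineticTheory.HeatConduction.partialP (⟨0, by omega⟩ : Fin N) φ) x + (T - δ / 2) * Literature.MathematicalPhysics.KineticTheory.HeatConduction.partialP (⟨N - 1, by omega⟩ : Fin N) (Literature.MathematicalPhysics.KineticTheory.HeatConduction.partialP (⟨N - 1, by omega⟩ : Fin N) φ) x) + 2 * γ * φ x + ε * Literature.MathematicalPhysics.KineticTheory.HeatConduction.flipNoise N φ x) = ∫ x, (-(Summit.AtomisticToContinuum.FouriersLaw.Theorems.SuperadditiveResistance.DeviceLiouville.kin N 0 x - T) + ∫ y, (Summit.AtomisticToContinuum.FouriersLaw.Theorems.SuperadditiveResistance.DeviceLiouville.kin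 N 0 y - T) ∂(μ N (T + δ / 2) (T - δ / 2))) * φ x) → ∀ (A₀ B₀ : ℝ), Filter.Tendsto (fun δ => ∫ x, g δ x * (Summit.AtomisticToContinuum.FouriersLaw.Theorems.SuperadditiveResistance.DeviceLiouville.kin N 0 x - T) ∂((Literature.MathematicalPhysics.KineticTheory.HeatConduction.pinnedChain ω₂ lam β γ).gibbsMeasure N T)) (nhdsWithin 0 {(0 : ℝ)}ᶜ) (nhds A₀) → Filter.Tendsto (fun δ => ∫ x, g δ x * (Summit.AtomisticToContinuum.FouriersLaw.Theorems.SuperadditiveResistance.DeviceLiouville.kin N (N - 1) x - T) ∂((Literature.MathematicalPhysics.KineticTheory.HeatConduction.pinnedChain ω₂ lam β γ).gibbsMeasure N T)) (nhdsWithin 0 {(0 : ℝ)}ᶜ) (nhds B₀) → Filter.Tendsto (fun δ : ℝ => (Literature.MathematicalPhysics.KineticTheory.HeatConduction.pinnedChain ω₂ lam β γ).totalCurrent (μ N (T + δ / 2) (T - δ / 2)) / δ) (nhdsWithin 0 {(0 : ℝ)}ᶜ) (nhds (((N : ℝ) - 1) * γ * (1 / 2 - γ / (2 * T ^ 2) *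 (A₀ - B₀)))) :=
  fun _ _ _ _ hω hl hβ hγ _ hT ε _ hμ _ h2 _ _ hδ₀ hbound hweak _ _ hA hB =>
    tendsto_response_of_dualRoad hω hl hβ hγ hT ε hμ h2 hδ₀ hbound hweak hA hB

end Summit.AtomisticToContinuum.FouriersLaw.Theorems.NoisyFourier.FlipFiniteResponse

end
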